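import Mathlib
import HarnessLib

/-!
# Stub `stub_rademacherTube` (R1) of crux `ConfinementPositivity` (stmt-CriticalPhenomena-17587),
# line `Sketch` (card sign-universality): the universal Rademacher tube lemma

A distribution-free small-ball LOWER bound for `±`-walks with prescribed steps.  Let
`h : Fin n → ℕ` be step sizes with `2 hᵢ ≤ r` (`r ≥ 1`) and total variance `∑ hᵢ² ≤ K r²`.  Among
the `2ⁿ` sign patterns `σ : Fin n → Bool`, those keeping EVERY partial sum
`S_k(σ) = ∑_{i<k} ±hᵢ` (`k = 0, …, n`) in the tube `[-r, r]` number at least `2ⁿ / 256^(K+1)`: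

`stub_rademacherTube : ∃ C, 0 < C ∧ ∀ n r K h, 1 ≤ r → (∀ i, 2 hᵢ ≤ r) → ∑ hᵢ² ≤ K r² →
  2ⁿ ≤ C^(K+1) · #{σ | ∀ k ≤ n, |S_k(σ)| ≤ r}` (with `C = 256`).

This is hypothesis `hR1` of the glue `ConfinementPositivity_of` of the lead skeleton
(`Cruxes/ConfinementPositivity/Lines/Sketch.lean`); the statement inlines `signedPartialSum`.

## Proof (cosine sub-solution / principal-eigenfunction comparison)

Put `a = π/(2r)` and, for a start `y : ℤ`, let `N(m, g, y)` be the number of sign patterns of the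
steps `g : Fin m → ℕ` keeping `y + S_k` in `[-r, r]` for all `k ≤ m`.  Peeling the first step gives
the recursion `N(m+1, g, y) = [|y| ≤ r] · (N(m, g', y + g₀) + N(m, g', y - g₀))`
(`rademacherTube_sum_succ`, via `Fin.consEquiv`).  Since `cos(a(y+g₀)) + cos(a(y-g₀)) =
2 cos(a y) cos(a g₀)`, `cos(a gᵢ) ≥ 0` (`a gᵢ ≤ π/4`) and `cos(a y) ≤ 0` for `r < |y| ≤ 3r/2`,
induction on `m` gives the CLAIM (`rademacherTube_cos_claim`)

`N(m, g, y) ≥ 2^m cos(a y) ∏ᵢ cos(a gᵢ)` whenever `2|y| ≤ 3r`.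

At `y = 0`: `#tube ≥ 2ⁿ ∏ cos(a hᵢ) ≥ 2ⁿ exp(-a² ∑ hᵢ²) ≥ 2ⁿ exp(-(π²/4) K) ≥ 2ⁿ exp(-5/2)^K
≥ 2ⁿ 256^{-K}`, using `cos x ≥ 1 - x²/2 ≥ 1/(1+x²) ≥ exp(-x²)` on `[0, 1]`
(`rademacherTube_exp_neg_sq_le_cos`), `π < 3.15` and `exp(-5/6) ≥ 1/6`.

Pure finite combinatorics and elementary real analysis over Mathlib (`Real.one_sub_sq_div_two_le_cos`,
`Real.add_one_le_exp`, `Real.pi_lt_d2`, `Fin.consEquiv`, `Finset.sum_boole`); folklore (the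
discrete analogue of the Dirichlet principal eigenfunction `cos(πx/2r)` of an interval).  Nothing
about self-avoiding walks is used.  No `def`s: the counting expression is inlined in every statement.
-/

noncomputable section
open scoped BigOperators
open Classical

namespace Summit.CriticalPhenomena.SAWScalingLimit.Theorems

/-- Splitting a bounded universal quantifier over `k ≤ m + 1` into `k = 0` and `k + 1 ≤ m + 1`. -/
theorem rademacherTube_forall_le_succ_iff (m : ℕ) (P : ℕ → Prop) :
    (∀ k ≤ m + 1, P k) ↔ P 0 ∧ ∀ k ≤ m, P (k + 1) := by
  constructor
  · intro h
    exact ⟨h 0 (Nat.zero_le _), fun k hk => h (k + 1) (Nat.succ_le_succ hk)⟩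
  · rintro ⟨h0, hs⟩ k hk
    cases k with
    | zero => exact h0
    | succ k => exact hs k (Nat.le_of_succ_le_succ hk)

/-- One-step recursion of the tube count (start `y` with `|y| ≤ r`): peel off the first step. -/
theorem rademacherTube_sum_succ (r : ℤ) (m : ℕ) (g : Fin (m + 1) → ℕ) (y : ℤ) (hy : |y| ≤ r) :
    (∑ σ : Fin (m + 1) → Bool, if (∀ k ≤ m + 1, |y + ∑ i : Fin (m + 1), (if (i : ℕ) < k then
        (if σ i then (g i : ℤ) else -(g i : ℤ)) else 0)| ≤ r) then (1 : ℝ) else 0) =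
      (∑ σ : Fin m → Bool, if (∀ k ≤ m, |(y + g 0) + ∑ i : Fin m, (if (i : ℕ) < k then
          (if σ i then (g i.succ : ℤ) else -(g i.succ : ℤ)) else 0)| ≤ r) then (1 : ℝ) else 0) +
      (∑ σ : Fin m → Bool, if (∀ k ≤ m, |(y - g 0) + ∑ i : Fin m, (if (i : ℕ) < k then
          (if σ i then (g i.succ : ℤ) else -(g i.succ : ℤ)) else 0)| ≤ r) then (1 : ℝ) else 0) := by
  rw [← (Fin.consEquiv fun _ => Bool).sum_comp, Fintype.sum_prod_type, Fintype.sum_bool]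
  simp only [Fin.consEquiv_apply, Fin.sum_univ_succ, Fin.cons_zero, Fin.cons_succ, Fin.val_zero,
    Fin.val_succ, rademacherTube_forall_le_succ_iff, lt_self_iff_false, not_lt_zero, if_false,
    Finset.sum_const_zero, add_zero, hy, true_and, Nat.zero_lt_succ, if_true,
    Nat.add_one_lt_add_one_iff, Bool.false_eq_true, add_assoc, sub_eq_add_neg]

/-- The step angle `π g / (2 r)` lies in `[0, π/4]` when `2 g ≤ r`. -/
theorem rademacherTube_step_angle (r g : ℕ) (hr : 1 ≤ r) (hg : 2 * g ≤ r) :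
    0 ≤ Real.pi / (2 * r) * g ∧ Real.pi / (2 * r) * g ≤ Real.pi / 4 := by
  have hr' : (0 : ℝ) < r := by exact_mod_cast hr
  have hg' : 2 * (g : ℝ) ≤ r := by exact_mod_cast hg
  refine ⟨by positivity, ?_⟩
  rw [div_mul_eq_mul_div, div_le_div_iff₀ (by positivity) (by norm_num)]
  nlinarith [Real.pi_pos]

/-- Each step factor `cos (π g / (2 r))` is nonnegative when `2 g ≤ r` (`r ≥ 1`). -/
theorem rademacherTube_cos_step_nonneg (r g : ℕ) (hr : 1 ≤ r) (hg : 2 * g ≤ r) :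
    0 ≤ Real.cos (Real.pi / (2 * r) * g) := by
  obtain ⟨h0, h1⟩ := rademacherTube_step_angle r g hr hg
  exact Real.cos_nonneg_of_neg_pi_div_two_le_of_le (by linarith [Real.pi_pos])
    (by linarith [Real.pi_pos])

/-- The start factor `cos (π y / (2 r))` is nonpositive when `r < |y| ≤ 3 r / 2`. -/
theorem rademacherTube_cos_start_nonpos (r : ℕ) (y : ℤ) (hr : 1 ≤ r) (h1 : (r : ℤ) < |y|)
    (h2 : 2 * |y| ≤ 3 * (r : ℤ)) : Real.cos (Real.pi / (2 * r) * y) ≤ 0 := by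
  have hr' : (0 : ℝ) < r := by exact_mod_cast hr
  have ht1 : (r : ℝ) ≤ |(y : ℝ)| := by rw [← Int.cast_abs]; exact_mod_cast h1.le
  have ht2 : 2 * |(y : ℝ)| ≤ 3 * r := by rw [← Int.cast_abs]; exact_mod_cast h2
  rw [← Real.cos_abs, abs_mul, abs_of_pos (by positivity : 0 < Real.pi / (2 * r))]
  apply Real.cos_nonpos_of_pi_div_two_le_of_le
  · rw [div_mul_eq_mul_div, div_le_div_iff₀ (by norm_num) (by positivity)]
    nlinarith [Real.pi_pos]
  · rw [div_mul_eq_mul_div, div_le_iff₀ (by positivity)]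
    nlinarith [Real.pi_pos]

/-- The left-hand side `2^m cos(π y/(2r)) ∏ cos(π gᵢ/(2r))` of the cosine claim is nonpositive when the
start is outside the tube (`r < |y| ≤ 3r/2`). -/
theorem rademacherTube_lhs_nonpos (r m : ℕ) (g : Fin m → ℕ) (y : ℤ) (hr : 1 ≤ r)
    (hg : ∀ i, 2 * g i ≤ r) (h1 : (r : ℤ) < |y|) (h2 : 2 * |y| ≤ 3 * (r : ℤ)) :
    (2 : ℝ) ^ m * Real.cos (Real.pi / (2 * r) * y) *
        ∏ i : Fin m, Real.cos (Real.pi / (2 * r) * g i) ≤ 0 := by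
  have hc := rademacherTube_cos_start_nonpos r y hr h1 h2
  have hp : 0 ≤ ∏ i : Fin m, Real.cos (Real.pi / (2 * r) * g i) :=
    Finset.prod_nonneg fun i _ => rademacherTube_cos_step_nonneg r (g i) hr (hg i)
  have h2m : (0 : ℝ) ≤ 2 ^ m := by positivity
  nlinarith [mul_nonneg h2m hp]

/-- **Cosine sub-solution claim.**  For steps `gᵢ ≤ r/2` and a start `y` with `|y| ≤ 3r/2`, the number of
sign patterns keeping `y + S_k` in `[-r, r]` for all `k ≤ m` is at least
`2^m cos(π y/(2r)) ∏ᵢ cos(π gᵢ/(2r))` (induction on `m`, peeling the first step, `cos (p+q) + cos (p-q)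
= 2 cos p cos q`). -/
theorem rademacherTube_cos_claim (r : ℕ) (hr : 1 ≤ r) (m : ℕ) :
    ∀ (g : Fin m → ℕ) (y : ℤ), (∀ i, 2 * g i ≤ r) → 2 * |y| ≤ 3 * (r : ℤ) →
      (2 : ℝ) ^ m * Real.cos (Real.pi / (2 * r) * y) *
          ∏ i : Fin m, Real.cos (Real.pi / (2 * r) * g i) ≤
        ∑ σ : Fin m → Bool, if (∀ k ≤ m, |y + ∑ i : Fin m, (if (i : ℕ) < k then
            (if σ i then (g i : ℤ) else -(g i : ℤ)) else 0)| ≤ (r : ℤ)) then (1 : ℝ) else 0 := by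
  induction m with
  | zero =>
    intro g y hg hy
    by_cases hyr : |y| ≤ (r : ℤ)
    · have h : (2 : ℝ) ^ 0 * Real.cos (Real.pi / (2 * r) * y) *
          ∏ i : Fin 0, Real.cos (Real.pi / (2 * r) * g i) ≤ 1 := by
        simpa using Real.cos_le_one _
      refine h.trans (le_of_eq ?_)
      simp [hyr]
    · exact (rademacherTube_lhs_nonpos r 0 g y hr hg (not_le.mp hyr) hy).trans
        (Finset.sum_nonneg fun σ _ => ite_nonneg zero_le_one le_rfl)
  | succ m ih =>
    intro g y hg hy
    by_cases hyr : |y| ≤ (r : ℤ)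
    · rw [rademacherTube_sum_succ (r : ℤ) m g y hyr, Fin.prod_univ_succ]
      have hg' : ∀ i : Fin m, 2 * g i.succ ≤ r := fun i => hg i.succ
      have hg0 : 2 * (g 0 : ℤ) ≤ r := by exact_mod_cast hg 0
      have habs0 : |(g 0 : ℤ)| = g 0 := abs_of_nonneg (by positivity)
      have hy1 : 2 * |y + (g 0 : ℤ)| ≤ 3 * (r : ℤ) := by
        have := abs_add_le y (g 0 : ℤ)
        linarith
      have hy2 : 2 * |y - (g 0 : ℤ)| ≤ 3 * (r : ℤ) := by
        have := abs_sub y (g 0 : ℤ)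
        linarith
      have h1 := ih (fun i => g i.succ) (y + g 0) hg' hy1
      have h2 := ih (fun i => g i.succ) (y - g 0) hg' hy2
      refine le_trans (le_of_eq ?_) (add_le_add h1 h2)
      push_cast
      rw [mul_add, mul_sub, Real.cos_add, Real.cos_sub]
      ring
    · exact (rademacherTube_lhs_nonpos r (m + 1) g y hr hg (not_le.mp hyr) hy).trans
        (Finset.sum_nonneg fun σ _ => ite_nonneg zero_le_one le_rfl)

/-- `exp (-x²) ≤ cos x` on `[0, 1]`: `cos x ≥ 1 - x²/2 ≥ 1/(1 + x²) ≥ exp (-x²)`. -/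
theorem rademacherTube_exp_neg_sq_le_cos {x : ℝ} (h0 : 0 ≤ x) (h1 : x ≤ 1) :
    Real.exp (-x ^ 2) ≤ Real.cos x := by
  have hx2 : x ^ 2 ≤ 1 := by nlinarith
  have hcos := Real.one_sub_sq_div_two_le_cos (x := x)
  have hexp : x ^ 2 + 1 ≤ Real.exp (x ^ 2) := Real.add_one_le_exp _
  have hpos : 0 < Real.exp (x ^ 2) := Real.exp_pos _
  have hE : Real.exp (-x ^ 2) * Real.exp (x ^ 2) = 1 := by
    rw [← Real.exp_add]; simp
  have hE0 : 0 < Real.exp (-x ^ 2) := Real.exp_pos _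
  nlinarith [mul_le_mul_of_nonneg_left hexp hE0.le, sq_nonneg x, mul_nonneg (sq_nonneg x) (sq_nonneg x)]

/-- Lower bound for the product of the step factors: `∏ cos(π hᵢ/(2r)) ≥ exp(-5/2)^K` when
`∑ hᵢ² ≤ K r²` (using `cos x ≥ exp(-x²)` on `[0,1]` and `π² ≤ 10`). -/
theorem rademacherTube_prod_cos_ge {n : ℕ} (r K : ℕ) (h : Fin n → ℕ) (hr : 1 ≤ r)
    (hh : ∀ i, 2 * h i ≤ r) (hK : (∑ i, h i ^ 2) ≤ K * r ^ 2) :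
    Real.exp (-(5 / 2 : ℝ)) ^ K ≤ ∏ i : Fin n, Real.cos (Real.pi / (2 * r) * h i) := by
  have hr' : (0 : ℝ) < r := by exact_mod_cast hr
  have hK' : (∑ i, ((h i : ℝ)) ^ 2) ≤ K * (r : ℝ) ^ 2 := by exact_mod_cast hK
  have hpi : Real.pi ^ 2 ≤ 10 := by nlinarith [Real.pi_lt_d2, Real.pi_pos]
  have hfac : ∀ i, Real.exp (-(Real.pi / (2 * r) * h i) ^ 2) ≤
      Real.cos (Real.pi / (2 * r) * h i) := fun i => by
    obtain ⟨h0, h1⟩ := rademacherTube_step_angle r (h i) hr (hh i)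
    exact rademacherTube_exp_neg_sq_le_cos h0 (by linarith [Real.pi_le_four])
  calc Real.exp (-(5 / 2 : ℝ)) ^ K = Real.exp (K * (-(5 / 2 : ℝ))) := (Real.exp_nat_mul _ _).symm
    _ ≤ Real.exp (∑ i : Fin n, -(Real.pi / (2 * r) * h i) ^ 2) := by
        rw [Real.exp_le_exp]
        have hsum : ∑ i : Fin n, -(Real.pi / (2 * r) * h i) ^ 2 =
            -((Real.pi / (2 * r)) ^ 2 * ∑ i, ((h i : ℝ)) ^ 2) := by
          rw [Finset.mul_sum, ← Finset.sum_neg_distrib]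
          refine Finset.sum_congr rfl fun i _ => ?_
          ring
        have ha : (Real.pi / (2 * r)) ^ 2 * (K * (r : ℝ) ^ 2) = Real.pi ^ 2 / 4 * K := by
          field_simp
          ring
        have hmono : (Real.pi / (2 * r)) ^ 2 * ∑ i, ((h i : ℝ)) ^ 2 ≤
            (Real.pi / (2 * r)) ^ 2 * (K * (r : ℝ) ^ 2) :=
          mul_le_mul_of_nonneg_left hK' (sq_nonneg _)
        rw [hsum]
        have hK0 : (0 : ℝ) ≤ K := by positivity
        nlinarith
    _ = ∏ i : Fin n, Real.exp (-(Real.pi / (2 * r) * h i) ^ 2) := Real.exp_sum _ _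
    _ ≤ ∏ i : Fin n, Real.cos (Real.pi / (2 * r) * h i) :=
        Finset.prod_le_prod (fun i _ => (Real.exp_pos _).le) fun i _ => hfac i

/-- The numerical constant: `1 ≤ 256 · exp(-5/2)` (from `exp(-5/6) ≥ 1/6`). -/
theorem rademacherTube_one_le_const : (1 : ℝ) ≤ 256 * Real.exp (-(5 / 2 : ℝ)) := by
  have h := Real.add_one_le_exp (-(5 / 6) : ℝ)
  have h3 : Real.exp (-(5 / 2) : ℝ) = Real.exp (-(5 / 6)) ^ 3 := by
    rw [← Real.exp_nat_mul]
    norm_num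
  rw [h3]
  have h6 : (1 / 6 : ℝ) ≤ Real.exp (-(5 / 6)) := by linarith
  have h6' : (1 / 6 : ℝ) ^ 3 ≤ Real.exp (-(5 / 6)) ^ 3 := by gcongr
  nlinarith

/-- **R1, the universal Rademacher tube lemma** (stub `stub_rademacherTube` of the line `Sketch` of crux
`ConfinementPositivity`): with `C = 256`, if all steps satisfy `2 hᵢ ≤ r` and `∑ hᵢ² ≤ K r²`, then at
least `2ⁿ / C^{K+1}` of the `2ⁿ` sign patterns keep every partial sum `∑_{i<k} ±hᵢ` in `[-r, r]`. -/
theorem stub_rademacherTube :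
    ∃ C : ℕ, 0 < C ∧ ∀ (n r K : ℕ) (h : Fin n → ℕ), 1 ≤ r →
      (∀ i, 2 * h i ≤ r) → (∑ i, h i ^ 2) ≤ K * r ^ 2 →
        2 ^ n ≤ C ^ (K + 1) *
          ((Finset.univ : Finset (Fin n → Bool)).filter
            (fun σ => ∀ k ≤ n, |∑ i : Fin n, (if (i : ℕ) < k then
              (if σ i then (h i : ℤ) else -(h i : ℤ)) else 0)| ≤ (r : ℤ))).card := by
  refine ⟨256, by norm_num, ?_⟩
  intro n r K h hr hh hK
  have hclaim := rademacherTube_cos_claim r hr n h 0 hh (by simp)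
  simp only [Int.cast_zero, mul_zero, Real.cos_zero, mul_one, zero_add, Finset.sum_boole] at hclaim
  have hprod := rademacherTube_prod_cos_ge r K h hr hh hK
  have hq := rademacherTube_one_le_const
  set q := Real.exp (-(5 / 2 : ℝ))
  have hq0 : 0 ≤ q := (Real.exp_pos _).le
  have hreal : (2 : ℝ) ^ n ≤ 256 ^ (K + 1) *
      (((Finset.univ : Finset (Fin n → Bool)).filter
            (fun σ => ∀ k ≤ n, |∑ i : Fin n, (if (i : ℕ) < k then
              (if σ i then (h i : ℤ) else -(h i : ℤ)) else 0)| ≤ (r : ℤ))).card : ℝ) :=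
    calc (2 : ℝ) ^ n ≤ 2 ^ n * (256 * q) ^ K * 256 := by
          have h1 : (1 : ℝ) ≤ (256 * q) ^ K := one_le_pow₀ hq
          have h2 : (0 : ℝ) ≤ 2 ^ n := by positivity
          nlinarith [mul_le_mul_of_nonneg_left h1 h2]
      _ = 256 ^ (K + 1) * (2 ^ n * q ^ K) := by ring
      _ ≤ 256 ^ (K + 1) * (2 ^ n * ∏ i : Fin n, Real.cos (Real.pi / (2 * r) * h i)) := by
          gcongr
      _ ≤ _ := by gcongr
  exact_mod_cast hreal

end Summit.CriticalPhenomena.SAWScalingLimit.Theorems
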